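import Summits.Parity.GeneralizedHardyLittlewood.Theorems.LiouvilleShiftedTablesSieveToMAvgI2Corner

/-!
# Sieve glue for `SieveToMAvg`, part 7e: Type I₂ — the bound for one modulus

Support file for item stmt-Parity-14274 (route `LiouvilleShiftedTables`).  For one modulus `q`
coprime to `h`, the correlation sum of a triple product `γ ⋆ 𝟙_{(s₁,s₂]} ⋆ 𝟙_{(n₁,n₂]}` is bounded
by slicing `r` and `s` into pieces of ratio `1 + Δ` and applying the local decomposition of part 7b
on each slice (`abs_corr_triple_le`):

  `|corr_q| ≤ ∑_{ρ<K_r} ∑_{i<K_s} ∑_r |γ_ρ(r)| · (four corners |D(q,r; ·, ·)|)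
            + ∑_r |γ(r)| ∑_s 𝟙_{(s₁,s₂]}(s) · (#thin₁ + #thin₂)(q, rs)`.
-/

namespace Summit.Parity.GeneralizedHardyLittlewood.Theorems.SieveToMAvg

open Finset Real
open scoped ArithmeticFunction.zeta ArithmeticFunction.sigma
open Literature.NumberTheory.Sieve.BFI

section PerQ

variable (h q : ℕ) (x Δ R : ℝ) (γ : ArithmeticFunction ℝ) (s₁ s₂ n₁ n₂ : ℝ)

/-- `P₀(ρ, i) = R_ρ · a_i`. [folklore] -/
noncomputable def P0 (ρ i : ℕ) : ℝ := boxLow R Δ ρ * sA s₁ s₂ Δ i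

/-- The four-corner majorant of the `(ρ, i)`-slice at `(q, r)`:
`|D(b_i, M)| + |D(a_i, M)| + |D(b_i, L*)| + |D(a_i, L*)|`. [folklore] -/
noncomputable def D4 (ρ i r : ℕ) : ℝ :=
  |Dsum h q r (sB s₂ Δ i) (cutM x (P0 Δ R s₁ s₂ ρ i) n₂)| +
  |Dsum h q r (sA s₁ s₂ Δ i) (cutM x (P0 Δ R s₁ s₂ ρ i) n₂)| +
  |Dsum h q r (sB s₂ Δ i) (cutL x Δ (P0 Δ R s₁ s₂ ρ i) n₁ n₂)| +
  |Dsum h q r (sA s₁ s₂ Δ i) (cutL x Δ (P0 Δ R s₁ s₂ ρ i) n₁ n₂)|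

/-- The thin-set count at `(q, m)`: `#{n ∈ thin₁ : m n ≡ h (q)} + #{n ∈ thin₂ : m n ≡ h (q)}`. [folklore] -/
noncomputable def thinCount (m : ℕ) : ℝ :=
  ((((thin₁ Δ n₁).filter (fun n => m * n ≡ h [MOD q])).card : ℕ) : ℝ) +
  ((((thin₂ Δ n₂).filter (fun n => m * n ≡ h [MOD q])).card : ℕ) : ℝ)

variable {h q x Δ R γ s₁ s₂ n₁ n₂}

/-- `thinCount ≥ 0`. [folklore] -/
theorem thinCount_nonneg (m : ℕ) : 0 ≤ thinCount h q Δ n₁ n₂ m := by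
  unfold thinCount; positivity

/-- `D4 ≥ 0`. [folklore] -/
theorem D4_nonneg (ρ i r : ℕ) : 0 ≤ D4 h q x Δ R s₁ s₂ n₁ n₂ ρ i r := by
  unfold D4; positivity

/-- **One slice**: for `r` in the `ρ`-th `r`-piece (`R_ρ < r ≤ (1+Δ)R_ρ`), the piece sum
`T_i(q, r) = ∑_{s ∈ (a_i, b_i]} boxCrossSum(q, r, s)` satisfies
`|T_i(q,r)| ≤ D4(ρ,i,r) + ∑_{s ∈ (a_i,b_i]} thinCount(q, rs)`. [folklore] -/
theorem abs_pieceSum_le (hx : 0 ≤ x) (hΔ : 0 < Δ) (hR : 0 < R) (hs₂ : 0 < s₂) (hn₁ : 0 ≤ n₁) (hn₁₂ : n₁ ≤ n₂)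
    (ρ i : ℕ) {r : ℕ} (hr1 : boxLow R Δ ρ < r) (hr2 : (r : ℝ) ≤ (1 + Δ) * boxLow R Δ ρ) :
    |∑ s ∈ Ioc ⌊sA s₁ s₂ Δ i⌋₊ ⌊sB s₂ Δ i⌋₊, boxCrossSum h q r s x n₁ n₂| ≤
      D4 h q x Δ R s₁ s₂ n₁ n₂ ρ i r +
        ∑ s ∈ Ioc ⌊sA s₁ s₂ Δ i⌋₊ ⌊sB s₂ Δ i⌋₊, thinCount h q Δ n₁ n₂ (r * s) := by
  set P₀ := P0 Δ R s₁ s₂ ρ i with hP₀def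
  have hΔ' : (-1 : ℝ) < Δ := by linarith
  have hRρ : 0 < boxLow R Δ ρ := boxLow_pos hR hΔ' ρ
  have hlo : 0 < boxLow s₂ Δ i := boxLow_pos hs₂ hΔ' i
  have hloA : boxLow s₂ Δ i ≤ sA s₁ s₂ Δ i := boxLow_le_sA hs₂.le hΔ.le i
  have hA0 : 0 < sA s₁ s₂ Δ i := hlo.trans_le hloA
  have hP₀ : 0 < P₀ := mul_pos hRρ hA0
  have hAB : sA s₁ s₂ Δ i ≤ sB s₂ Δ i := sA_le_sB i
  have hn₂ : 0 ≤ n₂ := hn₁.trans hn₁₂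
  -- main part = `regionSum`, error from the local decomposition
  have hmain : (∑ s ∈ Ioc ⌊sA s₁ s₂ Δ i⌋₊ ⌊sB s₂ Δ i⌋₊, hypSum h q r s x Δ P₀ n₁ n₂) =
      regionSum h q r (sA s₁ s₂ Δ i) (sB s₂ Δ i) (cutL x Δ P₀ n₁ n₂) (cutM x P₀ n₂) := rfl
  have hreg : |regionSum h q r (sA s₁ s₂ Δ i) (sB s₂ Δ i) (cutL x Δ P₀ n₁ n₂) (cutM x P₀ n₂)| ≤
      D4 h q x Δ R s₁ s₂ n₁ n₂ ρ i r := by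
    rw [regionSum_eq h q r hAB cutL_le_cutM]
    unfold D4
    have e : P0 Δ R s₁ s₂ ρ i = P₀ := rfl
    rw [e]
    have h1 := abs_add_le (Dsum h q r (sB s₂ Δ i) (cutM x P₀ n₂) - Dsum h q r (sA s₁ s₂ Δ i) (cutM x P₀ n₂) -
      Dsum h q r (sB s₂ Δ i) (cutL x Δ P₀ n₁ n₂)) (Dsum h q r (sA s₁ s₂ Δ i) (cutL x Δ P₀ n₁ n₂))
    have h2 := abs_sub (Dsum h q r (sB s₂ Δ i) (cutM x P₀ n₂) - Dsum h q r (sA s₁ s₂ Δ i) (cutM x P₀ n₂))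
      (Dsum h q r (sB s₂ Δ i) (cutL x Δ P₀ n₁ n₂))
    have h3 := abs_sub (Dsum h q r (sB s₂ Δ i) (cutM x P₀ n₂)) (Dsum h q r (sA s₁ s₂ Δ i) (cutM x P₀ n₂))
    linarith
  have herr : ∀ s ∈ Ioc ⌊sA s₁ s₂ Δ i⌋₊ ⌊sB s₂ Δ i⌋₊,
      |boxCrossSum h q r s x n₁ n₂ - hypSum h q r s x Δ P₀ n₁ n₂| ≤ thinCount h q Δ n₁ n₂ (r * s) := by
    intro s hs
    obtain ⟨hs1, hs2⟩ := Finset.mem_Ioc.1 hs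
    have hsA : sA s₁ s₂ Δ i < s := Nat.lt_of_floor_lt hs1
    have hsB : (s : ℝ) ≤ sB s₂ Δ i := by
      have hB0 : 0 ≤ sB s₂ Δ i := by unfold sB boxHigh; positivity
      exact (Nat.le_floor_iff hB0).1 hs2
    have hs0 : (0 : ℝ) < s := hA0.trans hsA
    -- `P₀ < rs ≤ (1+Δ)² P₀`
    have hrs1 : P₀ < (r : ℝ) * s := by
      calc P₀ = boxLow R Δ ρ * sA s₁ s₂ Δ i := rfl
        _ < (r : ℝ) * s := mul_lt_mul'' hr1 hsA hRρ.le hA0.le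
    have hrs2 : (r : ℝ) * s ≤ (1 + Δ) ^ 2 * P₀ := by
      have hsB' : (s : ℝ) ≤ (1 + Δ) * boxLow s₂ Δ i := by
        unfold sB at hsB; rwa [boxHigh_eq_mul_boxLow hΔ'] at hsB
      calc (r : ℝ) * s ≤ ((1 + Δ) * boxLow R Δ ρ) * ((1 + Δ) * boxLow s₂ Δ i) :=
            mul_le_mul hr2 hsB' hs0.le (by positivity)
        _ = (1 + Δ) ^ 2 * (boxLow R Δ ρ * boxLow s₂ Δ i) := by ring
        _ ≤ (1 + Δ) ^ 2 * P₀ := by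
            refine mul_le_mul_of_nonneg_left ?_ (by positivity)
            exact mul_le_mul_of_nonneg_left hloA hRρ.le
    exact boxCrossSum_decomp hx hΔ.le hP₀ hrs1 hrs2 hn₁ hn₁₂
  -- combine
  have hsplit : (∑ s ∈ Ioc ⌊sA s₁ s₂ Δ i⌋₊ ⌊sB s₂ Δ i⌋₊, boxCrossSum h q r s x n₁ n₂) =
      regionSum h q r (sA s₁ s₂ Δ i) (sB s₂ Δ i) (cutL x Δ P₀ n₁ n₂) (cutM x P₀ n₂) +
      ∑ s ∈ Ioc ⌊sA s₁ s₂ Δ i⌋₊ ⌊sB s₂ Δ i⌋₊, (boxCrossSum h q r s x n₁ n₂ - hypSum h q r s x Δ P₀ n₁ n₂) := by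
    rw [← hmain, ← Finset.sum_add_distrib]
    exact Finset.sum_congr rfl fun s _ => by ring
  rw [hsplit]
  refine (abs_add_le _ _).trans (add_le_add hreg ?_)
  exact (Finset.abs_sum_le_sum_abs _ _).trans (Finset.sum_le_sum herr)

/-- **The bound for one modulus.**  For `q` with `(q, h) = 1`, `γ` supported on `r ≤ R`
(`0 < R < (1+Δ)^{K_r}`), `0 < s₂ ≤ 2x`, `s₂ < (1+Δ)^{K_s}`, `0 ≤ n₁ ≤ n₂`, `x > 0`, `Δ > 0`:
`|corr_q| ≤ ∑_{ρ,i} ∑_r |γ_ρ(r)| D4(ρ,i,r) + ∑_r |γ(r)| ∑_s indAF(s) thinCount(q, rs)`. [folklore] -/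
theorem abs_corr_triple_le (hx : 0 < x) (hΔ : 0 < Δ) (hR : 0 < R) {K_r : ℕ} (hKr : R < (1 + Δ) ^ K_r)
    (hγ : ∀ r : ℕ, γ r ≠ 0 → (r : ℝ) ≤ R) (hs₂ : 0 < s₂) (hs₂x : s₂ ≤ 2 * x) {K_s : ℕ}
    (hKs : s₂ < (1 + Δ) ^ K_s) (hn₁ : 0 ≤ n₁) (hn₁₂ : n₁ ≤ n₂) :
    |corr (lamW h) h q x (fun n => (γ * indAF s₁ s₂ * indAF n₁ n₂) n)| ≤
      (∑ ρ ∈ Finset.range K_r, ∑ i ∈ Finset.range K_s, ∑ r ∈ Ioc 0 ⌊2 * x⌋₊,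
        |boxRestrict R Δ ρ γ r| * D4 h q x Δ R s₁ s₂ n₁ n₂ ρ i r) +
      ∑ r ∈ Ioc 0 ⌊2 * x⌋₊, |γ r| * ∑ s ∈ Ioc 0 ⌊2 * x⌋₊, indAF s₁ s₂ s * thinCount h q Δ n₁ n₂ (r * s) := by
  set N := ⌊2 * x⌋₊ with hN
  rw [corr_triple_eq]
  -- per `r`
  have hper : ∀ r ∈ Ioc 0 N, |γ r * Tsum h q x s₁ s₂ n₁ n₂ r| ≤
      (∑ ρ ∈ Finset.range K_r, ∑ i ∈ Finset.range K_s, |boxRestrict R Δ ρ γ r| * D4 h q x Δ R s₁ s₂ n₁ n₂ ρ i r) +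
      |γ r| * ∑ s ∈ Ioc 0 N, indAF s₁ s₂ s * thinCount h q Δ n₁ n₂ (r * s) := by
    intro r hr
    have hr0 : 0 < r := (Finset.mem_Ioc.1 hr).1
    by_cases hγ0 : γ r = 0
    · rw [hγ0, zero_mul, abs_zero]
      have : ∀ ρ, boxRestrict R Δ ρ γ r = 0 := fun ρ => by rw [boxRestrict_apply]; split_ifs <;> simp [hγ0]
      simp only [this, abs_zero, zero_mul, Finset.sum_const_zero, zero_add, le_refl]
    have hrR : (r : ℝ) ≤ R := hγ r hγ0
    -- `γ r = ∑_ρ γ_ρ r`, `T = ∑_i T_i`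
    have hγsum : γ r = ∑ ρ ∈ Finset.range K_r, boxRestrict R Δ ρ γ r :=
      (sum_boxRestrict_apply hR hΔ hKr γ hr0 hrR).symm
    have hTsum : Tsum h q x s₁ s₂ n₁ n₂ r =
        ∑ i ∈ Finset.range K_s, ∑ s ∈ Ioc ⌊sA s₁ s₂ Δ i⌋₊ ⌊sB s₂ Δ i⌋₊, boxCrossSum h q r s x n₁ n₂ :=
      sum_indAF_mul_eq_sum_pieces hs₂ hs₂x hΔ hKs _
    -- the thin part through the pieces too
    have hthin : ∑ s ∈ Ioc 0 N, indAF s₁ s₂ s * thinCount h q Δ n₁ n₂ (r * s) =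
        ∑ i ∈ Finset.range K_s, ∑ s ∈ Ioc ⌊sA s₁ s₂ Δ i⌋₊ ⌊sB s₂ Δ i⌋₊, thinCount h q Δ n₁ n₂ (r * s) :=
      sum_indAF_mul_eq_sum_pieces hs₂ hs₂x hΔ hKs _
    have hL : γ r * Tsum h q x s₁ s₂ n₁ n₂ r =
        ∑ ρ ∈ Finset.range K_r, boxRestrict R Δ ρ γ r * Tsum h q x s₁ s₂ n₁ n₂ r := by
      rw [← Finset.sum_mul, ← hγsum]
    rw [hL, hthin]
    refine (Finset.abs_sum_le_sum_abs _ _).trans ?_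
    -- each `ρ`
    have hρ : ∀ ρ ∈ Finset.range K_r, |boxRestrict R Δ ρ γ r * Tsum h q x s₁ s₂ n₁ n₂ r| ≤
        (∑ i ∈ Finset.range K_s, |boxRestrict R Δ ρ γ r| * D4 h q x Δ R s₁ s₂ n₁ n₂ ρ i r) +
        |boxRestrict R Δ ρ γ r| * ∑ i ∈ Finset.range K_s, ∑ s ∈ Ioc ⌊sA s₁ s₂ Δ i⌋₊ ⌊sB s₂ Δ i⌋₊,
          thinCount h q Δ n₁ n₂ (r * s) := by
      intro ρ _
      by_cases hz : boxRestrict R Δ ρ γ r = 0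
      · rw [hz]; simp
      obtain ⟨hin, -⟩ := boxRestrict_ne_zero hz
      obtain ⟨_, hr1, hr2⟩ := hin
      rw [boxHigh_eq_mul_boxLow (by linarith : (-1 : ℝ) < Δ)] at hr2
      rw [abs_mul, hTsum]
      have hrhs : (∑ i ∈ Finset.range K_s, |boxRestrict R Δ ρ γ r| * D4 h q x Δ R s₁ s₂ n₁ n₂ ρ i r) +
          |boxRestrict R Δ ρ γ r| * ∑ i ∈ Finset.range K_s, ∑ s ∈ Ioc ⌊sA s₁ s₂ Δ i⌋₊ ⌊sB s₂ Δ i⌋₊,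
            thinCount h q Δ n₁ n₂ (r * s) =
          |boxRestrict R Δ ρ γ r| * ∑ i ∈ Finset.range K_s, (D4 h q x Δ R s₁ s₂ n₁ n₂ ρ i r +
            ∑ s ∈ Ioc ⌊sA s₁ s₂ Δ i⌋₊ ⌊sB s₂ Δ i⌋₊, thinCount h q Δ n₁ n₂ (r * s)) := by
        rw [Finset.mul_sum, Finset.mul_sum, ← Finset.sum_add_distrib]
        exact Finset.sum_congr rfl fun i _ => by ring
      rw [hrhs]
      refine mul_le_mul_of_nonneg_left ?_ (abs_nonneg _)
      refine (Finset.abs_sum_le_sum_abs _ _).trans (Finset.sum_le_sum fun i _ => ?_)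
      exact abs_pieceSum_le hx.le hΔ hR hs₂ hn₁ hn₁₂ ρ i hr1 hr2
    refine (Finset.sum_le_sum hρ).trans ?_
    rw [Finset.sum_add_distrib, ← Finset.sum_mul]
    refine add_le_add le_rfl (mul_le_mul_of_nonneg_right ?_ ?_)
    · exact sum_abs_boxRestrict_le hR hΔ.le K_r γ r
    · exact Finset.sum_nonneg fun i _ => Finset.sum_nonneg fun s _ => thinCount_nonneg _
  refine (Finset.abs_sum_le_sum_abs _ _).trans ((Finset.sum_le_sum hper).trans ?_)
  rw [Finset.sum_add_distrib]
  refine add_le_add (le_of_eq ?_) le_rfl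
  rw [Finset.sum_comm]
  refine Finset.sum_congr rfl fun ρ _ => ?_
  rw [Finset.sum_comm]

end PerQ

end Summit.Parity.GeneralizedHardyLittlewood.Theorems.SieveToMAvg
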